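import Literature.LinearAlgebra.TateCommutantDimension
import Mathlib.LinearAlgebra.Charpoly.BaseChange
import HarnessLib

/-!
# Tate's commutant under base change: `dim_K End_{K[γ_K]}(V_K) = dim_k End_{k[γ]}(V)` for a semisimple `γ` over a
# perfect field — «the integer `r(f)` is independent of `k`» in use (Milne 1999, §7, proof of Prop. 7.4, display (∗))

Family `hodge`, lane `lit-hodgefound` (foundations library; seat `lit-hodgefound-p27`, generation 22, row g22-#3);
topic `LinearAlgebra`.  Sequel of `Literature.LinearAlgebra.TateCommutantDimension` (g22-#1).  Theorems only
(0 `sorry`, 0 new axioms, no definition, no named fact, net debt 0, D-0026).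

## The source, verbatim

J. S. Milne, *Lefschetz motives and the Tate conjecture*, Compositio Math. 117 (1999), §7 p. 75 (held
`paper:doi-10-1023-a-1000776613765` p0031 L1–L9 and the display (∗)): «The integer `r(f) = Σ m(P)² deg(P)` is
independent of `k`.  If a semisimple endomorphism `γ` of a `k`-vector space `V` has characteristic polynomial `f(t)`,
then `dim_k End_{k[γ]}(V) = r(f)`.» (Tate 1966, p. 138), applied with `k = ℚ_ℓ` and «For any field `k ⊃ ℚ_ℓ` and fibre
functor `ω` … `End(Y) ⊗_{ℚ_ℓ} k ≅ End_k(ω(Y))^M` … the dimension of the second space is `r(f_{π_Y})`» — i.e. the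
dimension of the commutant of a semisimple operator does not change under extension of scalars, because both sides
equal `r(f)` and `r(f)` is independent of the field.  THIS FILE proves exactly that consequence, for a perfect base
field `k` (where `γ_K` stays semisimple): `finrank_centralizer_baseChange_eq`.

## What is formalised

* `baseChange_aeval`: `(p(γ))_K = p_K(γ_K)` (base change is an algebra homomorphism `Module.End.baseChangeHom`).
* `IsSemisimple.baseChange_of_perfectField`: over a PERFECT field, a semisimple `γ` stays semisimple after any
  extension of scalars `K/k` (its minimal polynomial is separable, so squarefree in `K[X]`, and kills `γ_K`).  (The
  tree's `Literature.AlgebraicGeometry.Motives.isSemisimple_baseChange` is the case `ℚ → ℂ`; this is the general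
  perfect-field form, same three-line proof.)
* **`finrank_centralizer_baseChange_eq`**: `finrank K (Subalgebra.centralizer K {γ.baseChange K}) =
  finrank k (Subalgebra.centralizer k {γ})` for `γ` semisimple over a perfect `k` — by g22-#1's
  `finrank_centralizer_eq_tateR_charpoly` on both sides, Mathlib's `LinearMap.charpoly_baseChange`
  (`f_{γ_K} = f_γ` mapped to `K[X]`) and g22-#1's `tateR_map_eq` («`r(f)` is independent of `k`»); and the explicit
  value `finrank_centralizer_baseChange_eq_tateR` (`= r(f_γ)`).

Nothing in this file is a case of the Hodge conjecture; Prop. 7.4 itself is NOT claimed.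

## References

* [Milne1999] J. S. Milne, *Lefschetz motives and the Tate conjecture*, Compositio Math. 117 (1999) 45–76 — §7,
  proof of Prop. 7.4, p. 75 L1–L9 and display (∗).
* [Tate1966Endomorphisms] J. Tate, *Endomorphisms of abelian varieties over finite fields*, Invent. Math. 2 (1966)
  134–144 — p. 138 (not held; CITE-ONLY acq-00408; through [Milne1999]).

Provenance: lane `lit-hodgefound`, seat `lit-hodgefound-p27` gen 22 (agent `literature-prover-lit-hodgefound-p27-g22-0`),
row g22-#3.
-/

set_option autoImplicit false

open Polynomial Module
open scoped TensorProduct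

namespace Literature.LinearAlgebra

variable {k : Type*} [Field k] {V : Type*} [AddCommGroup V] [Module k V]
variable (K : Type*) [Field K] [Algebra k K]

/-- **Base change commutes with polynomial calculus**: `(p(γ))_K = p_K(γ_K)`. [cite: Milne1999, §7 p. 75 (∗)] -/
theorem baseChange_aeval (γ : Module.End k V) (p : k[X]) :
    (aeval γ p).baseChange K = aeval (γ.baseChange K) (p.map (algebraMap k K)) := by
  rw [aeval_map_algebraMap]
  exact (aeval_algHom_apply (Module.End.baseChangeHom k K V) γ p).symm

/-- **Over a perfect field, semisimplicity survives extension of scalars**: if `γ` is semisimple then so is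
`γ_K = γ ⊗ 1` on `V_K = K ⊗_k V` (the minimal polynomial of `γ` is separable, hence squarefree over `K`, and
annihilates `γ_K`). [cite: Milne1999, §7 p. 75 L7–L9 («semisimple endomorphism … independent of `k`»)] -/
theorem IsSemisimple.baseChange_of_perfectField [PerfectField k] {γ : Module.End k V} [FiniteDimensional k V]
    (hγ : γ.IsSemisimple) : Module.End.IsSemisimple (γ.baseChange K : Module.End K (K ⊗[k] V)) := by
  have hsep : (minpoly k γ).Separable := PerfectField.separable_iff_squarefree.2 hγ.minpoly_squarefree
  refine Module.End.isSemisimple_of_squarefree_aeval_eq_zero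
    (p := (minpoly k γ).map (algebraMap k K)) (hsep.map (f := algebraMap k K)).squarefree ?_
  rw [← baseChange_aeval, minpoly.aeval, LinearMap.baseChange_zero]

/-- **Tate's commutant has the same dimension after extension of scalars** (`k` perfect, `γ` semisimple):
`dim_K End_{K[γ_K]}(V_K) = dim_k End_{k[γ]}(V)` — both equal `r(f_γ)` (Tate's lemma on each side, `f_{γ_K} = f_γ`
in `K[X]`, and «the integer `r(f)` is independent of `k`»).  This is how Milne uses the independence in display (∗).
[cite: Milne1999, §7 p. 75 L7–L9 and (∗)] [cite: Tate1966Endomorphisms, p. 138] -/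
theorem finrank_centralizer_baseChange_eq [PerfectField k] [FiniteDimensional k V] (γ : Module.End k V)
    (hγ : γ.IsSemisimple) :
    finrank K (Subalgebra.centralizer K ({γ.baseChange K} : Set (Module.End K (K ⊗[k] V)))) =
      finrank k (Subalgebra.centralizer k ({γ} : Set (Module.End k V))) := by
  rw [finrank_centralizer_eq_tateR_charpoly _ (IsSemisimple.baseChange_of_perfectField K hγ),
    LinearMap.charpoly_baseChange, tateR_map_eq, finrank_centralizer_eq_tateR_charpoly γ hγ]

/-- The explicit value after base change: `dim_K End_{K[γ_K]}(V_K) = r(f_γ)`, computed over `k`.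
[cite: Milne1999, §7 p. 75 L7–L9 and (∗)] [cite: Tate1966Endomorphisms, p. 138] -/
theorem finrank_centralizer_baseChange_eq_tateR [PerfectField k] [FiniteDimensional k V] (γ : Module.End k V)
    (hγ : γ.IsSemisimple) :
    finrank K (Subalgebra.centralizer K ({γ.baseChange K} : Set (Module.End K (K ⊗[k] V)))) = tateR γ.charpoly := by
  rw [finrank_centralizer_baseChange_eq K γ hγ, finrank_centralizer_eq_tateR_charpoly γ hγ]

end Literature.LinearAlgebra
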